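import Summits.Ventures.CertifiedManyBodySolver.Observables.SourcedGibbsTrialCapKSpaceSymbol
import HarnessLib

/-!
# The HF–BCS sourced cap in momentum space (XIII-a): the spin-density-wave + BCS quasiparticle SPECTRUM in closed form
# (real algebra of the `2 × 2` square-blocks of file (X))

HONEST FRAMING: zero compute; PROVED identities/inequalities between real numbers; no number is claimed. These are the side
conditions and the eigenvalue identification needed to apply `fermi_mulVec_of_sq_pair` (file (XI)) to the plane-wave pairs of
the antiferromagnetic + `d`-wave-pinned Nambu matrix (file (X)): with `a = (ε − μ')² + g² + M²`, `a' = (−ε − μ')² + g² + M²`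
(the diagonal of `𝓗²` on `(χ_p, χ_{p+Q})`, `ε_{p+Q} = −ε_p`) and `b = −2μ'M` (resp. `+2μ'M` on the hole sheet):
`a + a' ≥ 0`, `b² ≤ a a'`, and the two square-eigenvalues are `m ± r = (√(ε² + M²) ± |μ'|)² + g²` — the closed form
`E_±(k) = √((√(ε_k² + M²) ± μ')² + Δ_k²)` of the spin-density-wave + BCS spectrum at `t' = 0`. Not a statement about order.

Cell `hubbard-obs` (D-0042 / D-0082), seat `hubbard-obs-pin-2` (`prover-hubbard-obs-pin-2-g7-0`).

References: J. E. Hirsch, Phys. Rev. B 31 (1985) 4403 [HirschPRB1985]; Bach–Lieb–Solovej, J. Stat. Phys. 76 (1994) 3, §2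
[BachLiebSolovej1994].
-/

noncomputable section

namespace Summit.Ventures.CertifiedManyBodySolver.Observables

section AFSpectrum

/-- The mean of the two diagonal entries of the square-block: `(a + a')/2 = (ε² + M²) + μ'² + g²`. [cite: HirschPRB1985] -/
theorem af_sq_block_mean (ε μ' g M : ℝ) :
    (((ε - μ') ^ 2 + g ^ 2 + M ^ 2) + ((-ε - μ') ^ 2 + g ^ 2 + M ^ 2)) / 2 = (ε ^ 2 + M ^ 2) + μ' ^ 2 + g ^ 2 := by
  ring

/-- The discriminant of the square-block: `((a − a')/2)² + b² = 4μ'²(ε² + M²)` (`b = ∓2μ'M`). [cite: HirschPRB1985] -/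
theorem af_sq_block_disc (ε μ' g M : ℝ) :
    ((((ε - μ') ^ 2 + g ^ 2 + M ^ 2) - ((-ε - μ') ^ 2 + g ^ 2 + M ^ 2)) / 2) ^ 2 + (-(2 * μ' * M)) ^ 2 =
      4 * μ' ^ 2 * (ε ^ 2 + M ^ 2) := by
  ring

/-- `√(((a − a')/2)² + b²) = 2|μ'|√(ε² + M²)`. [cite: HirschPRB1985] -/
theorem af_sq_block_sqrt_disc (ε μ' g M : ℝ) :
    Real.sqrt (((((ε - μ') ^ 2 + g ^ 2 + M ^ 2) - ((-ε - μ') ^ 2 + g ^ 2 + M ^ 2)) / 2) ^ 2 + (-(2 * μ' * M)) ^ 2) =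
      2 * |μ'| * Real.sqrt (ε ^ 2 + M ^ 2) := by
  rw [af_sq_block_disc, show (4 * μ' ^ 2 * (ε ^ 2 + M ^ 2) : ℝ) = (2 * |μ'|) ^ 2 * (ε ^ 2 + M ^ 2) by
    rw [mul_pow, sq_abs]; ring, Real.sqrt_mul (by positivity), Real.sqrt_sq (by positivity)]

/-- **The upper square-eigenvalue is `E₊²`**: `m + r = (√(ε² + M²) + |μ'|)² + g²`. [cite: HirschPRB1985] [cite: BachLiebSolovej1994, §2] -/
theorem af_sq_block_eigen_plus (ε μ' g M : ℝ) :
    (((ε - μ') ^ 2 + g ^ 2 + M ^ 2) + ((-ε - μ') ^ 2 + g ^ 2 + M ^ 2)) / 2 +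
        Real.sqrt (((((ε - μ') ^ 2 + g ^ 2 + M ^ 2) - ((-ε - μ') ^ 2 + g ^ 2 + M ^ 2)) / 2) ^ 2 + (-(2 * μ' * M)) ^ 2) =
      (Real.sqrt (ε ^ 2 + M ^ 2) + |μ'|) ^ 2 + g ^ 2 := by
  rw [af_sq_block_sqrt_disc, af_sq_block_mean]
  have hR := Real.sq_sqrt (show (0 : ℝ) ≤ ε ^ 2 + M ^ 2 by positivity)
  have hμ : |μ'| ^ 2 = μ' ^ 2 := sq_abs μ'
  nlinarith [hR, hμ]

/-- **The lower square-eigenvalue is `E₋²`**: `m − r = (√(ε² + M²) − |μ'|)² + g²`. [cite: HirschPRB1985] [cite: BachLiebSolovej1994, §2] -/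
theorem af_sq_block_eigen_minus (ε μ' g M : ℝ) :
    (((ε - μ') ^ 2 + g ^ 2 + M ^ 2) + ((-ε - μ') ^ 2 + g ^ 2 + M ^ 2)) / 2 -
        Real.sqrt (((((ε - μ') ^ 2 + g ^ 2 + M ^ 2) - ((-ε - μ') ^ 2 + g ^ 2 + M ^ 2)) / 2) ^ 2 + (-(2 * μ' * M)) ^ 2) =
      (Real.sqrt (ε ^ 2 + M ^ 2) - |μ'|) ^ 2 + g ^ 2 := by
  rw [af_sq_block_sqrt_disc, af_sq_block_mean]
  have hR := Real.sq_sqrt (show (0 : ℝ) ≤ ε ^ 2 + M ^ 2 by positivity)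
  have hμ : |μ'| ^ 2 = μ' ^ 2 := sq_abs μ'
  nlinarith [hR, hμ]

/-- Side condition `0 ≤ a + a'` of `fermi_mulVec_of_sq_pair`. [folklore] -/
theorem af_sq_block_sum_nonneg (ε μ' g M : ℝ) :
    0 ≤ ((ε - μ') ^ 2 + g ^ 2 + M ^ 2) + ((-ε - μ') ^ 2 + g ^ 2 + M ^ 2) := by
  positivity

/-- Side condition `b² ≤ a a'` of `fermi_mulVec_of_sq_pair`: `a a' − b² = ((√(ε²+M²) − |μ'|)² + g²)((√(ε²+M²) + |μ'|)² + g²) ≥ 0`.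
[cite: HirschPRB1985] -/
theorem af_sq_block_det_nonneg (ε μ' g M : ℝ) :
    (-(2 * μ' * M)) ^ 2 ≤ ((ε - μ') ^ 2 + g ^ 2 + M ^ 2) * ((-ε - μ') ^ 2 + g ^ 2 + M ^ 2) := by
  -- `a a' − b² = (ε² + M² + μ'² + g²)² − 4μ'²(ε² + M²) = (S − 2μ'²)… ≥ 0` via `(ε² + M² + μ'² + g²)² ≥ (ε² + M² + μ'²)² ≥ 4μ'²(ε² + M²)`
  nlinarith [sq_nonneg (ε ^ 2 + M ^ 2 - μ' ^ 2), sq_nonneg g, sq_nonneg (ε ^ 2 + M ^ 2 + μ' ^ 2), sq_nonneg ε, sq_nonneg M,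
    sq_nonneg μ', mul_nonneg (sq_nonneg g) (sq_nonneg g),
    mul_nonneg (sq_nonneg g) (add_nonneg (add_nonneg (sq_nonneg ε) (sq_nonneg M)) (sq_nonneg μ'))]

/-- The same two side conditions and eigenvalues on the HOLE sheet (`b = +2μ'M`): the discriminant only sees `b²`. [folklore] -/
theorem af_sq_block_disc_hole (ε μ' g M : ℝ) :
    ((((ε - μ') ^ 2 + g ^ 2 + M ^ 2) - ((-ε - μ') ^ 2 + g ^ 2 + M ^ 2)) / 2) ^ 2 + (2 * μ' * M) ^ 2 =
      ((((ε - μ') ^ 2 + g ^ 2 + M ^ 2) - ((-ε - μ') ^ 2 + g ^ 2 + M ^ 2)) / 2) ^ 2 + (-(2 * μ' * M)) ^ 2 := by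
  ring

end AFSpectrum

end Summit.Ventures.CertifiedManyBodySolver.Observables

end
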